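import Mathlib.Data.ZMod.QuotientRing
import Literature.NumberTheory.EllipticCurves.NewformAbelianVariety
import Literature.NumberTheory.EllipticCurves.NewformsHeckeProofs
import HarnessLib

/-!
# BirchSwinnertonDyer / ShadowIsolation — crux `PhantomShadow` (stmt-BirchSwinnertonDyer-15787),
# line `birth` (registered), congruence glue stub `stub_congruenceHom_of_ideal`

Registered stub of the skeleton `Cruxes/PhantomShadow/Lines/birth.lean` (reshape r3): the passage from a
congruence MODULO AN IDEAL of the coefficient order — the form in which every source states depth-`n`
congruences between Hecke eigensystems (Ribet 1990; Bertolini–Darmon 2005, `𝕋/I ≅ ℤ/pⁿ`;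
Cremona–Mazur 2000 §3 / Agashe–Stein 2002 Thm. 3.1, `A_g[𝔪] ≅ E[p]`; the interface
`NewformAbelianVariety.idealTorsion I = A_g[I]`) — to the TYPED congruence of the route decls
`PhantomShadow` / `IsolationOfAccidentalZeros`: a subring `R ⊆ ℂ` containing the Hecke eigenvalues
`heckeEigenvalue g ℓ` (`ℓ ∤ N` prime) and a ring homomorphism `φ : R →+* ZMod m` with prescribed
values `φ(a_ℓ(g)) = b_ℓ`.

Statement: for a newform `g ∈ S₂(Γ₀(N))` (`IsNewform0 g`), a modulus `m : ℕ`, integers `b : ℕ → ℤ`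
and an ideal `I` of `coeffOrder g = ℤ[{aₙ(g)}]` with `ℤ ∩ I ⊆ mℤ`
(`I.comap (algebraMap ℤ _) ≤ Ideal.span {(m : ℤ)}`) and `a_ℓ(g) − b_ℓ ∈ I` for every prime `ℓ ∤ N`,
there are `R`, `φ` and the membership proofs with `φ ⟨heckeEigenvalue g ℓ, _⟩ = b_ℓ`.

Proof: let `A = ℤ[{aₙ(g)}]`, `ψ : ℤ → A/I`; `ker ψ = ℤ ∩ I ⊆ mℤ`. Put `B := mk⁻¹(im ψ) ⊆ A` (a subring
containing every `a_ℓ(g)`, since `a_ℓ(g) ≡ b_ℓ`), `ρ : B → im ψ` the restriction of `A → A/I`,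
`χ : im ψ ≅ ℤ/ker ψ → ℤ/mℤ ≅ ZMod m`, `φ_B := χ ∘ ρ`, and transport along the embedding `A ⊆ ℂ`
(`R := B.map`, `Subring.equivMapOfInjective`). The value: `ρ(a_ℓ(g)) = ρ(b_ℓ)` in `A/I`, and a ring
homomorphism sends the integer `b_ℓ` to `b_ℓ mod m` (`map_intCast`). The identification
`heckeEigenvalue g ℓ = a_ℓ(g)` for the normalised eigenform `g` is the tree's theorem
`heckeEigenvalue_eq_coeff_of_isNormalized` (Atkin–Lehner 1970, Thm. 3; Diamond–Shurman Prop. 5.8.5).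
-/

set_option linter.dupNamespace false

noncomputable section

namespace Summit.BirchSwinnertonDyer.BirchSwinnertonDyer.Theorems

open Literature.NumberTheory.EllipticCurves.ModularForms

/-- Congruence glue (PROVED): an ideal `I ⊆ ℤ[{aₙ(g)}]` with `ℤ ∩ I ⊆ mℤ` and `a_ℓ(g) ≡ b_ℓ (mod I)` at the
primes `ℓ ∤ N` yields the crux's typed congruence — a subring `R ⊆ ℂ` containing the Hecke eigenvalues of
the newform `g` and `φ : R →+* ZMod m` with `φ(a_ℓ(g)) = b_ℓ` (statement `Sig.stub_congruenceHom_of_ideal`,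
inlined). `R` is the image in `ℂ` of the preimage `B ⊆ ℤ[{aₙ(g)}]` of `im(ℤ → ℤ[{aₙ(g)}]/I)`, and `φ` is
`B → im(ℤ) ≅ ℤ/ker → ℤ/mℤ ≅ ZMod m`; `heckeEigenvalue g ℓ = a_ℓ(g)` for the normalised eigenform `g` is the
tree's `heckeEigenvalue_eq_coeff_of_isNormalized` (Atkin–Lehner 1970, Thm. 3). [folklore] -/
theorem stub_congruenceHom_of_ideal : ∀ (N : ℕ) [NeZero N] (g : CuspForm (CongruenceSubgroup.Gamma0 N) 2), Literature.NumberTheory.EllipticCurves.ModularForms.IsNewform0 g → ∀ (m : ℕ) (b : ℕ → ℤ) (I : Ideal (Literature.NumberTheory.EllipticCurves.ModularForms.coeffOrder g)), Ideal.comap (algebraMap ℤ (Literature.NumberTheory.EllipticCurves.ModularForms.coeffOrder g)) I ≤ Ideal.span {(m : ℤ)} → (∀ ℓ : ℕ, ℓ.Prime → ¬ ℓ ∣ N → Literature.NumberTheory.EllipticCurves.ModularForms.coeffOrder.coeff g ℓ - (b ℓ : Literature.NumberTheory.EllipticCurves.ModularForms.coeffOrder g) ∈ I) → ∃ (R : Subring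 ℂ) (φ : R →+* ZMod m) (hR : ∀ ℓ : ℕ, ℓ.Prime → ¬ ℓ ∣ N → Literature.NumberTheory.EllipticCurves.ModularForms.heckeEigenvalue g ℓ ∈ R), ∀ (ℓ : ℕ) (hℓ : ℓ.Prime) (hℓN : ¬ ℓ ∣ N), φ ⟨Literature.NumberTheory.EllipticCurves.ModularForms.heckeEigenvalue g ℓ, hR ℓ hℓ hℓN⟩ = (b ℓ : ZMod m) := by
  intro N _ g hg m b I hI hcongr
  classical
  -- the embedding of the coefficient order `A = ℤ[{aₙ(g)}]` into `ℂ`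
  let fA : Literature.NumberTheory.EllipticCurves.ModularForms.coeffOrder g →+* ℂ :=
    SubringClass.subtype (Literature.NumberTheory.EllipticCurves.ModularForms.coeffOrder g)
  have hfA : Function.Injective fA := Subtype.val_injective
  -- `ψ : ℤ → A/I`, with kernel `ℤ ∩ I ⊆ mℤ`
  let ψ : ℤ →+* (Literature.NumberTheory.EllipticCurves.ModularForms.coeffOrder g ⧸ I) :=
    (Ideal.Quotient.mk I).comp (algebraMap ℤ (Literature.NumberTheory.EllipticCurves.ModularForms.coeffOrder g))
  have hker : RingHom.ker ψ ≤ Ideal.span {(m : ℤ)} := by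
    intro z hz
    apply hI
    rw [Ideal.mem_comap]
    rw [RingHom.mem_ker] at hz
    exact Ideal.Quotient.eq_zero_iff_mem.mp hz
  -- `B` = preimage in `A` of the subring `im ψ ⊆ A/I`; `ρ : B → im ψ`; `χ : im ψ → ZMod m`
  let B : Subring (Literature.NumberTheory.EllipticCurves.ModularForms.coeffOrder g) :=
    ψ.range.comap (Ideal.Quotient.mk I)
  let ρ : B →+* ψ.range := (Ideal.Quotient.mk I).restrict B ψ.range (fun x hx ↦ Subring.mem_comap.mp hx)
  let χ : ψ.range →+* ZMod m :=
    ((Int.quotientSpanNatEquivZMod m).toRingHom.comp (Ideal.Quotient.factor hker)).comp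
      (RingHom.quotientKerEquivRange ψ).symm.toRingHom
  let φB : B →+* ZMod m := χ.comp ρ
  -- the generators `a_ℓ(g)` lie in `B`, with `ρ(a_ℓ(g)) = ρ(b_ℓ)`
  have hmemB : ∀ ℓ : ℕ, ℓ.Prime → ¬ ℓ ∣ N →
      Literature.NumberTheory.EllipticCurves.ModularForms.coeffOrder.coeff g ℓ ∈ B := by
    intro ℓ hℓ hℓN
    change Ideal.Quotient.mk I (Literature.NumberTheory.EllipticCurves.ModularForms.coeffOrder.coeff g ℓ) ∈ ψ.range
    refine RingHom.mem_range.mpr ⟨b ℓ, ?_⟩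
    change Ideal.Quotient.mk I (algebraMap ℤ _ (b ℓ)) =
      Ideal.Quotient.mk I (Literature.NumberTheory.EllipticCurves.ModularForms.coeffOrder.coeff g ℓ)
    rw [eq_intCast]
    exact (Ideal.Quotient.eq.mpr (hcongr ℓ hℓ hℓN)).symm
  have hcoe : ∀ ℓ : ℕ, ℓ.Prime →
      fA (Literature.NumberTheory.EllipticCurves.ModularForms.coeffOrder.coeff g ℓ) =
        Literature.NumberTheory.EllipticCurves.ModularForms.heckeEigenvalue g ℓ := by
    intro ℓ hℓ
    change ((Literature.NumberTheory.EllipticCurves.ModularForms.coeffOrder.coeff g ℓ :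
        Literature.NumberTheory.EllipticCurves.ModularForms.coeffOrder g) : ℂ) = _
    rw [Literature.NumberTheory.EllipticCurves.ModularForms.coeffOrder.coe_coeff,
      heckeEigenvalue_eq_coeff_of_isNormalized hg.2.2 hℓ (hg.2.1 ℓ hℓ)]
  -- push `B` into `ℂ`
  let e : B ≃+* B.map fA := B.equivMapOfInjective fA hfA
  have hR : ∀ ℓ : ℕ, ℓ.Prime → ¬ ℓ ∣ N →
      Literature.NumberTheory.EllipticCurves.ModularForms.heckeEigenvalue g ℓ ∈ B.map fA := by
    intro ℓ hℓ hℓN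
    exact Subring.mem_map.mpr ⟨_, hmemB ℓ hℓ hℓN, hcoe ℓ hℓ⟩
  refine ⟨B.map fA, φB.comp e.symm.toRingHom, hR, ?_⟩
  intro ℓ hℓ hℓN
  have hex : e ⟨Literature.NumberTheory.EllipticCurves.ModularForms.coeffOrder.coeff g ℓ, hmemB ℓ hℓ hℓN⟩ =
      ⟨Literature.NumberTheory.EllipticCurves.ModularForms.heckeEigenvalue g ℓ, hR ℓ hℓ hℓN⟩ :=
    Subtype.ext (by rw [Subring.coe_equivMapOfInjective_apply]; exact hcoe ℓ hℓ)
  change φB (e.symm ⟨Literature.NumberTheory.EllipticCurves.ModularForms.heckeEigenvalue g ℓ, hR ℓ hℓ hℓN⟩) = _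
  rw [← hex, e.symm_apply_apply]
  have hρ : ρ ⟨Literature.NumberTheory.EllipticCurves.ModularForms.coeffOrder.coeff g ℓ, hmemB ℓ hℓ hℓN⟩ =
      ρ (b ℓ : B) := by
    apply Subtype.ext
    rw [RingHom.coe_restrict_apply, RingHom.coe_restrict_apply, Subring.coe_intCast, Ideal.Quotient.eq]
    exact hcongr ℓ hℓ hℓN
  calc φB ⟨_, hmemB ℓ hℓ hℓN⟩ = χ (ρ ⟨_, hmemB ℓ hℓ hℓN⟩) := rfl
    _ = χ (ρ (b ℓ : B)) := by rw [hρ]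
    _ = φB (b ℓ : B) := rfl
    _ = (b ℓ : ZMod m) := map_intCast φB (b ℓ)

end Summit.BirchSwinnertonDyer.BirchSwinnertonDyer.Theorems

end
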